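import Summits.BirchSwinnertonDyer.BirchSwinnertonDyer.Theses.UniversalToricDescent
import HarnessLib

/-!
# Route `UniversalToricDescent`: the DEPTH PARAMETER of the crux K1-at-3 `TwinMemberRationalInclusionAtThree`
# (stmt-BirchSwinnertonDyer-27934) IS IDLE — K1-at-3 is equivalent to its depth-`0` slice

Lead bsd-wall-utd-p2 g14 (line `membertower` v11 on ♭B′ `TwinWanFrameAtThreeMultTresT`, stmt-BirchSwinnertonDyer-27401),
`--supports` the crux. Statement hygiene for the vet / crux-ideate chain of 27934, kernel-checked.

The crux K1-at-3 (route rev 59, child of ♭B′) quantifies over every depth `m : ℕ` and every Skinner–Castella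
Hida congruent member `D : Skinner2016.HidaCongruentMember W′ 3 m` of the twin's newform (a `3`-ordinary newform
`g_m ∈ S_{k_m}(Γ₀(N′/3))`, `k_m > 2`, `k_m ≡ 2 (mod 2)`, with a `3`-adic embedding `ι`, an integral ordinary datum
`Δ`, the congruence `a_ℓ(g_m) ≡ a_ℓ(W′) (mod 3^m)` at the good primes and an equivariant `A_{g_m}[3^m] ≃ (W′[3^∞] ⊗ 𝒪)[3^m]`)
and asserts, for every typed `Σ`-imprimitive weight-`k_m` BDP frame `Q` of `g_m`, the RATIONAL Wan-side inclusion
`∃ e, (C 3)^e · Ch(X^Σ_ac(A_{g_m}; 𝔭′)) · 𝓞_{ℂ₃}⟦T⟧ ⊆ (Q)` under torsion. The CONCLUSION never mentions `m` or the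
congruence data: it only sees `D.g`, `D.ι`, `D.Δ`. Since a member at depth `m` is in particular a member at depth
`0` (the depth-`0` congruence `‖ι(a_ℓ(g)) − a_ℓ(W′)‖ ≤ 1` is weaker than the depth-`m` one, and the depth-`0`
torsion modules `A_g[3^0]`, `(W′[3^∞] ⊗ 𝒪)[3^0]` are zero, so the equivariant isomorphism is the zero map), the
crux is EQUIVALENT to its depth-`0` slice (`twinMemberRationalInclusionAtThree_iff_depthZero`).

Reading for the planners (numbers, not adjectives): at depth `0` the member structure carries NO congruence with
the twin beyond `3`-adic integrality of the difference of Hecke eigenvalues, so 27934 is — up to that idle clause —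
the rational anticyclotomic BDP lower bound at split `p = 3` for EVERY `3`-ordinary newform of level `N′/3` and
even weight `k > 2` carrying an integral ordinary datum, under the all-split Heegner field `K` of the twin setting:
the one-newform statement «F4 at `p = 3`, `N⁻ = 1`, weight `k`» with exponent `∃ e`. The member tower of ♭B′
(p633686 / p635340 / glue 27935) consumes it only at the members delivered by
`Castella2018.castella2020_thm211_members_frames_sigma_congruence_odd` (item 27933), depth by depth.
No definition, no named fact, no `sorry`; BSD is proved for no curve by this file.
-/

noncomputable section

open scoped Classical

set_option linter.dupNamespace false
set_option autoImplicit false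

namespace Summit.BirchSwinnertonDyer.BirchSwinnertonDyer.Theorems.UniversalToricDescentTwinMemberRationalInclusionAtThreeDepth

open PowerSeries WeierstrassCurve NumberField IsDedekindDomain Field
  Literature.NumberTheory.EllipticCurves
  Literature.NumberTheory.EllipticCurves.ModularForms
  Literature.NumberTheory.EllipticCurves.Rank1Residual
  Literature.NumberTheory.EllipticCurves.BigGaloisRep
  Literature.NumberTheory.EllipticCurves.GreenbergSelmer
  Literature.NumberTheory.GaloisRepresentations
  Summit.BirchSwinnertonDyer.Rank1Residual.X11b
  Summit.BirchSwinnertonDyer.Rank1Residual.X11b.Halves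
  Summit.BirchSwinnertonDyer.BirchSwinnertonDyer.Theorems.SchneiderFree
  Summit.BirchSwinnertonDyer.BirchSwinnertonDyer.Theses.UniversalToricDescent

/-- **K1-at-3 ⟹ its depth-`0` slice** (instantiate `m := 0`). The hypothesis is the route declaration
`TwinMemberRationalInclusionAtThree` (stmt-BirchSwinnertonDyer-27934) by name; the conclusion is its text with
`∀ (m : ℕ) (D : HidaCongruentMember W′ 3 m)` replaced by `∀ (D : HidaCongruentMember W′ 3 0)`. -/
theorem depthZero_of_twinMemberRationalInclusionAtThree (h : TwinMemberRationalInclusionAtThree) :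
    ∀ (W' : WeierstrassCurve ℚ) [W'.IsElliptic] [W'.IsGloballyMinimal] (N' : ℕ) [NeZero N']
      (K : Type) [Field K] [NumberField K] (Dt' : ModularParametrizationData W' N'),
      Mult W' 3 → W'.HasSurjectiveModNGaloisRep 3 → W'.conductorNorm ℤ = N' → IsImaginaryQuadratic K →
      SatisfiesHeegnerHypothesis N' K → Odd (NumberField.discr K) →
      ∀ (κ : ZpExtension K 3), κ.IsAnticyclotomic → ∀ (γ : absoluteGaloisGroup K) [Fact (κ.IsTopGenerator γ)]
        (𝔭 : HeightOneSpectrum (𝓞 K)), ((3 : ℕ) : 𝓞 K) ∈ 𝔭.asIdeal →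
        𝔭.asIdeal.ramificationIdx (𝓞 ℚ) = 1 → 𝔭.asIdeal.inertiaDeg (𝓞 ℚ) = 1 →
        ∀ (𝔭' : HeightOneSpectrum (𝓞 K)), ((3 : ℕ) : 𝓞 K) ∈ 𝔭'.asIdeal → 𝔭' ≠ 𝔭 →
        ∀ (ι' : PadicAlgCl 3 ≃+* ℂ), BranchInducesPrime 3 ι' 𝔭 →
        ∀ (D : Skinner2016.HidaCongruentMember W' 3 0), (∀ x : coeffField D.g, ι' (D.ι x) = (x : ℂ)) →
        ∀ (b : padicCoeffIntegers D.ι →+* 𝓞_ℂ_[3]),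
          (∀ x, ((b x : 𝓞_ℂ_[3]) : ℂ_[3]) = algebraMap (PadicAlgCl 3) ℂ_[3] (padicCoeffIntegers.toPadicAlgCl D.ι x)) →
        ∀ (ΩK : ℂ) (Ωp : (𝓞_ℂ_[3])ˣ) (Q : PowerSeries 𝓞_ℂ_[3]), ΩK ≠ 0 →
          IsBDPLFunctionWtSigmaInt ι' 𝔭 κ γ D.g (W'.sigmaPlacesFinset 3 K) ΩK ((Ωp : 𝓞_ℂ_[3]) : ℂ_[3]) Q →
        ∀ [TopologicalSpace (PowerSeries (padicCoeffIntegers D.ι))]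
          [ContinuousSMul (PowerSeries (padicCoeffIntegers D.ι))
            (BigRepModule (padicCoeffIntegers D.ι) 3 (Cofree D.Δ.ρ (padicCoeffField D.ι)))],
          Module.IsTorsion (PowerSeries (padicCoeffIntegers D.ι))
              (XBig κ (D.Δ.cofreeRepOver K) 𝔭' (↑(W'.sigmaPlacesFinset 3 K))) →
            ∃ e : ℕ, Ideal.span {(PowerSeries.C ((3 : ℕ) : 𝓞_ℂ_[3]) : PowerSeries 𝓞_ℂ_[3]) ^ e} *
                (XBig.charIdeal κ (D.Δ.cofreeRepOver K) 𝔭' (↑(W'.sigmaPlacesFinset 3 K))).map (PowerSeries.map b) ≤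
              Ideal.span {Q} :=
  fun W' _ _ N' _ K _ _ Dt' hmult hsurj hN' hK hH hodd κ hκ γ _ 𝔭 h𝔭 he hf 𝔭' h𝔭' hne ι' hι' D =>
    h W' N' K Dt' hmult hsurj hN' hK hH hodd κ hκ γ 𝔭 h𝔭 he hf 𝔭' h𝔭' hne ι' hι' 0 D

set_option maxHeartbeats 800000 in -- buildfix (bf3-g35): > 400k after route UniversalToricDescent rev 93 (12:03Z 08-30); passes at 600k/800k on the farm
/-- **The depth-`0` slice ⟹ K1-at-3**: a Hida congruent member `D` at depth `m` yields one at depth `0` with the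
SAME newform `D.g`, embedding `D.ι` and ordinary datum `D.Δ` (the congruence bound `(3^m)⁻¹ ≤ (3^0)⁻¹`; the
depth-`0` torsion modules are zero, so `LinearEquiv.ofSubsingleton` is the equivariant isomorphism), and the
conclusion of K1-at-3 only sees `(D.g, D.ι, D.Δ)`. -/
theorem twinMemberRationalInclusionAtThree_of_depthZero
    (h0 : ∀ (W' : WeierstrassCurve ℚ) [W'.IsElliptic] [W'.IsGloballyMinimal] (N' : ℕ) [NeZero N']
      (K : Type) [Field K] [NumberField K] (Dt' : ModularParametrizationData W' N'),
      Mult W' 3 → W'.HasSurjectiveModNGaloisRep 3 → W'.conductorNorm ℤ = N' → IsImaginaryQuadratic K →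
      SatisfiesHeegnerHypothesis N' K → Odd (NumberField.discr K) →
      ∀ (κ : ZpExtension K 3), κ.IsAnticyclotomic → ∀ (γ : absoluteGaloisGroup K) [Fact (κ.IsTopGenerator γ)]
        (𝔭 : HeightOneSpectrum (𝓞 K)), ((3 : ℕ) : 𝓞 K) ∈ 𝔭.asIdeal →
        𝔭.asIdeal.ramificationIdx (𝓞 ℚ) = 1 → 𝔭.asIdeal.inertiaDeg (𝓞 ℚ) = 1 →
        ∀ (𝔭' : HeightOneSpectrum (𝓞 K)), ((3 : ℕ) : 𝓞 K) ∈ 𝔭'.asIdeal → 𝔭' ≠ 𝔭 →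
        ∀ (ι' : PadicAlgCl 3 ≃+* ℂ), BranchInducesPrime 3 ι' 𝔭 →
        ∀ (D : Skinner2016.HidaCongruentMember W' 3 0), (∀ x : coeffField D.g, ι' (D.ι x) = (x : ℂ)) →
        ∀ (b : padicCoeffIntegers D.ι →+* 𝓞_ℂ_[3]),
          (∀ x, ((b x : 𝓞_ℂ_[3]) : ℂ_[3]) = algebraMap (PadicAlgCl 3) ℂ_[3] (padicCoeffIntegers.toPadicAlgCl D.ι x)) →
        ∀ (ΩK : ℂ) (Ωp : (𝓞_ℂ_[3])ˣ) (Q : PowerSeries 𝓞_ℂ_[3]), ΩK ≠ 0 →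
          IsBDPLFunctionWtSigmaInt ι' 𝔭 κ γ D.g (W'.sigmaPlacesFinset 3 K) ΩK ((Ωp : 𝓞_ℂ_[3]) : ℂ_[3]) Q →
        ∀ [TopologicalSpace (PowerSeries (padicCoeffIntegers D.ι))]
          [ContinuousSMul (PowerSeries (padicCoeffIntegers D.ι))
            (BigRepModule (padicCoeffIntegers D.ι) 3 (Cofree D.Δ.ρ (padicCoeffField D.ι)))],
          Module.IsTorsion (PowerSeries (padicCoeffIntegers D.ι))
              (XBig κ (D.Δ.cofreeRepOver K) 𝔭' (↑(W'.sigmaPlacesFinset 3 K))) →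
            ∃ e : ℕ, Ideal.span {(PowerSeries.C ((3 : ℕ) : 𝓞_ℂ_[3]) : PowerSeries 𝓞_ℂ_[3]) ^ e} *
                (XBig.charIdeal κ (D.Δ.cofreeRepOver K) 𝔭' (↑(W'.sigmaPlacesFinset 3 K))).map (PowerSeries.map b) ≤
              Ideal.span {Q}) :
    TwinMemberRationalInclusionAtThree := by
  intro W' _ _ N' _ K _ _ Dt' hmult hsurj hN' hK hH hodd κ hκ γ _ 𝔭 h𝔭 he hf 𝔭' h𝔭' hne ι' hι' m D hι b hb ΩK Ωp Q
    hΩK hQ _ _ hT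
  -- the depth-`0` torsion modules `A_g[3^0]`, `(W′[3^∞] ⊗ 𝒪)[3^0]` are zero
  haveI hsub₁ : Subsingleton (Skinner2016.MemberTorsion D.Δ 0) := by
    refine ⟨fun a c => Subtype.ext ?_⟩
    have ha : (a : Cofree D.Δ.ρ (padicCoeffField D.ι)) = 0 := by
      have := a.2
      rw [Submodule.mem_torsionBy_iff, pow_zero, one_smul] at this
      exact this
    have hc : (c : Cofree D.Δ.ρ (padicCoeffField D.ι)) = 0 := by
      have := c.2
      rw [Submodule.mem_torsionBy_iff, pow_zero, one_smul] at this
      exact this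
    rw [ha, hc]
  haveI hsub₂ : Subsingleton (Skinner2016.CurveCoeffTorsion (p := 3) W' D.ι 0) := by
    refine ⟨fun a c => Subtype.ext ?_⟩
    have ha : (a : Skinner2016.CurveCoeffModule (p := 3) W' D.ι) = 0 := by
      have := a.2
      rw [Submodule.mem_torsionBy_iff, pow_zero, one_smul] at this
      exact this
    have hc : (c : Skinner2016.CurveCoeffModule (p := 3) W' D.ι) = 0 := by
      have := c.2
      rw [Submodule.mem_torsionBy_iff, pow_zero, one_smul] at this
      exact this
    rw [ha, hc]
  -- the equivariant isomorphism at depth `0` is the zero map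
  have hequiv : ∃ e : Skinner2016.MemberTorsion D.Δ 0 ≃ₗ[padicCoeffIntegers D.ι]
      Skinner2016.CurveCoeffTorsion (p := 3) W' D.ι 0,
      ∀ (σ : absoluteGaloisGroup ℚ) (a : Skinner2016.MemberTorsion D.Δ 0),
        (e (torsionRep D.Δ.cofreeRep (((3 : ℕ) : padicCoeffIntegers D.ι) ^ 0) σ a) :
            Skinner2016.CurveCoeffModule (p := 3) W' D.ι) =
          Skinner2016.curveCoeffRep W' D.ι σ (e a : Skinner2016.CurveCoeffModule (p := 3) W' D.ι) := by
    refine ⟨LinearEquiv.ofSubsingleton (R := padicCoeffIntegers D.ι) (Skinner2016.MemberTorsion D.Δ 0)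
      (Skinner2016.CurveCoeffTorsion (p := 3) W' D.ι 0), fun σ a => ?_⟩
    rw [LinearEquiv.ofSubsingleton_apply, LinearEquiv.ofSubsingleton_apply, ZeroMemClass.coe_zero, map_zero]
  -- the member read at depth `0` (same `g`, `ι`, `Δ`; congruence bound `(3^m)⁻¹ ≤ (3^0)⁻¹`)
  have h31 : (((3 : ℕ) : ℝ) ^ m)⁻¹ ≤ (((3 : ℕ) : ℝ) ^ (0 : ℕ))⁻¹ := by
    rw [pow_zero, inv_one]
    exact inv_le_one_of_one_le₀ (one_le_pow₀ (by norm_num))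
  let D₀ : Skinner2016.HidaCongruentMember W' 3 0 :=
    ⟨⟨D.k, D.two_lt_k, D.dvd_k_sub_two, D.g, D.isNewform, D.ι, D.norm_coeff_p,
      fun ℓ hℓ hN => (D.norm_coeff_sub_le ℓ hℓ hN).trans h31, D.Δ⟩, hequiv⟩
  exact h0 W' N' K Dt' hmult hsurj hN' hK hH hodd κ hκ γ 𝔭 h𝔭 he hf 𝔭' h𝔭' hne ι' hι' D₀ hι b hb ΩK Ωp Q hΩK hQ hT

/-- **K1-at-3 ⟺ its depth-`0` slice** (the depth parameter and the congruence data of the member are idle in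
`TwinMemberRationalInclusionAtThree`). -/
theorem twinMemberRationalInclusionAtThree_iff_depthZero :
    TwinMemberRationalInclusionAtThree ↔
    ∀ (W' : WeierstrassCurve ℚ) [W'.IsElliptic] [W'.IsGloballyMinimal] (N' : ℕ) [NeZero N']
      (K : Type) [Field K] [NumberField K] (Dt' : ModularParametrizationData W' N'),
      Mult W' 3 → W'.HasSurjectiveModNGaloisRep 3 → W'.conductorNorm ℤ = N' → IsImaginaryQuadratic K →
      SatisfiesHeegnerHypothesis N' K → Odd (NumberField.discr K) →
      ∀ (κ : ZpExtension K 3), κ.IsAnticyclotomic → ∀ (γ : absoluteGaloisGroup K) [Fact (κ.IsTopGenerator γ)]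
        (𝔭 : HeightOneSpectrum (𝓞 K)), ((3 : ℕ) : 𝓞 K) ∈ 𝔭.asIdeal →
        𝔭.asIdeal.ramificationIdx (𝓞 ℚ) = 1 → 𝔭.asIdeal.inertiaDeg (𝓞 ℚ) = 1 →
        ∀ (𝔭' : HeightOneSpectrum (𝓞 K)), ((3 : ℕ) : 𝓞 K) ∈ 𝔭'.asIdeal → 𝔭' ≠ 𝔭 →
        ∀ (ι' : PadicAlgCl 3 ≃+* ℂ), BranchInducesPrime 3 ι' 𝔭 →
        ∀ (D : Skinner2016.HidaCongruentMember W' 3 0), (∀ x : coeffField D.g, ι' (D.ι x) = (x : ℂ)) →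
        ∀ (b : padicCoeffIntegers D.ι →+* 𝓞_ℂ_[3]),
          (∀ x, ((b x : 𝓞_ℂ_[3]) : ℂ_[3]) = algebraMap (PadicAlgCl 3) ℂ_[3] (padicCoeffIntegers.toPadicAlgCl D.ι x)) →
        ∀ (ΩK : ℂ) (Ωp : (𝓞_ℂ_[3])ˣ) (Q : PowerSeries 𝓞_ℂ_[3]), ΩK ≠ 0 →
          IsBDPLFunctionWtSigmaInt ι' 𝔭 κ γ D.g (W'.sigmaPlacesFinset 3 K) ΩK ((Ωp : 𝓞_ℂ_[3]) : ℂ_[3]) Q →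
        ∀ [TopologicalSpace (PowerSeries (padicCoeffIntegers D.ι))]
          [ContinuousSMul (PowerSeries (padicCoeffIntegers D.ι))
            (BigRepModule (padicCoeffIntegers D.ι) 3 (Cofree D.Δ.ρ (padicCoeffField D.ι)))],
          Module.IsTorsion (PowerSeries (padicCoeffIntegers D.ι))
              (XBig κ (D.Δ.cofreeRepOver K) 𝔭' (↑(W'.sigmaPlacesFinset 3 K))) →
            ∃ e : ℕ, Ideal.span {(PowerSeries.C ((3 : ℕ) : 𝓞_ℂ_[3]) : PowerSeries 𝓞_ℂ_[3]) ^ e} *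
                (XBig.charIdeal κ (D.Δ.cofreeRepOver K) 𝔭' (↑(W'.sigmaPlacesFinset 3 K))).map (PowerSeries.map b) ≤
              Ideal.span {Q} :=
  ⟨depthZero_of_twinMemberRationalInclusionAtThree, twinMemberRationalInclusionAtThree_of_depthZero⟩

end Summit.BirchSwinnertonDyer.BirchSwinnertonDyer.Theorems.UniversalToricDescentTwinMemberRationalInclusionAtThreeDepth

end
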